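import Literature.NumberTheory.Automorphic.CuspFormSliceReduction
import Literature.NumberTheory.Automorphic.WhittakerDecayArchIwasawa
import Literature.NumberTheory.Automorphic.WhittakerTowerDerivative
import Literature.NumberTheory.Automorphic.CuspFormsBoundedHC
import Literature.NumberTheory.Automorphic.ArchFlowParametricIntegral
import HarnessLib

/-!
# Uniform archimedean decay of the global Whittaker transform of a cusp form on `GL_n(𝔸_K)`

Topic `NumberTheory/Automorphic`; namespace `Literature.NumberTheory.Automorphic`. Proof file
(theorems only). For a cusp form `φ` on `GL_n(𝔸_K)` (Borel–Jacquet conditions, no central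
character assumed) and its Tate-normalised global Whittaker transform
`W_φ = whittakerDepth 0 φ` we PROVE the uniform decay estimate feeding the absolute convergence of
the Fourier–Whittaker expansion (Cogdell (2004), Thm. 1.1; Jacquet–Piatetski-Shapiro–Shalika):

* `IsCuspFormGL.isArchSmooth_continuous_bounded_iterLieDeriv_of_center'` — an `A_G`-invariant cusp
  form has smooth, continuous and BOUNDED iterated archimedean derivatives (uniform moderate growth,
  `IsCuspFormGL.hasUniformModerateGrowth_of_center'`, and boundedness of `A_G`-invariant cusp forms,
  `IsCuspFormGL.bounded_of_center'`, both proved in `CuspFormsBoundedHC`);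
* `exists_norm_whittakerDepth_zero_pow_mul_pow_le`, `exists_norm_whittakerDepth_zero_mul_pow_le` —
  telescoping the single-root decay of `WhittakerDecayArchIwasawa` along the simple roots
  `e_l - e_{l+1}, …, e_{n-2} - e_{n-1}`: in Iwasawa coordinates `g_∞ = d κ`, `d_{i,w} = r_i > 0`, one
  has `‖W_φ(g)‖ · r_l^M ≤ C · r_{n-1}^M` for every row index `l` and every `M`, with `C`
  independent of `g`;
* `IsCuspFormGL.exists_norm_whittakerDepth_zero_mul_pow_le` — the same bound for an ARBITRARY cusp
  form `φ` on a determinant slice `|det g|_𝔸 = |det x₀|_𝔸`, by the reduction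
  `φ ↦ φ♭ = φ ∘ r_{x₀}` to an `A_G`-invariant cusp form agreeing with `φ` on the slice
  (`CuspFormSliceReduction`: `isCuspFormGL_sliceExtend`, `whittakerDepth_sliceExtend_eq`).

## References

* J. W. Cogdell, *Analytic theory of L-functions for GL_n*, in: An introduction to the Langlands
  program (2004), Thm. 1.1 [CogdellAnalyticTheory2004].
* C. Moeglin, J.-L. Waldspurger, *Spectral decomposition and Eisenstein series* (1995), I.2.10–I.2.18
  [MoeglinWaldspurger1995].
* A. Borel, H. Jacquet, *Automorphic forms and automorphic representations* (1979), 4.2–4.4, 5.7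
  [BorelJacquet1979].
-/

noncomputable section

open MeasureTheory NumberField NumberField.mixedEmbedding NumberField.InfinitePlace IsDedekindDomain Matrix Set
  Filter Topology
open scoped MatrixGroups Classical NNReal

namespace Literature.NumberTheory.Automorphic

variable {n : ℕ} {K : Type} [Field K] [NumberField K]

/-! ### Derivatives of an `A_G`-invariant cusp form are smooth, continuous and bounded -/

section AGInvariant

variable {hcpt : isCompact_glFiniteIntegralLevel n K}

/-- **Iterated archimedean derivatives of an `A_G`-invariant cusp form are `A_G`-invariant cusp
forms, hence smooth, continuous and bounded** (uniform moderate growth of `A_G`-invariant cusp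
forms and boundedness of `A_G`-invariant cusp forms, `CuspFormsBoundedHC`; derivatives commute with
left translations). [cite: BorelJacquet1979, 4.3 (ii) and 4.4] -/
theorem IsCuspFormGL.isArchSmooth_continuous_bounded_iterLieDeriv_of_center'
    {φ : (AdelicGroupData.gl n K).Adelic → ℂ} (hφ : IsCuspFormGL n K hcpt φ)
    (hA : ∀ z ∈ (AdelicGroupData.gl n K).center', ∀ g : (AdelicGroupData.gl n K).Adelic, φ (z * g) = φ g)
    (l : List (archGroupGL n K).lie) :
    IsCuspFormGL n K hcpt (iterLieDeriv (glArch n K) l φ) ∧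
      (∀ z ∈ (AdelicGroupData.gl n K).center', ∀ g : (AdelicGroupData.gl n K).Adelic,
        iterLieDeriv (glArch n K) l φ (z * g) = iterLieDeriv (glArch n K) l φ g) ∧
      IsArchSmooth (glArch n K) (iterLieDeriv (glArch n K) l φ) ∧ Continuous (iterLieDeriv (glArch n K) l φ) ∧
      ∃ C : ℝ, ∀ z, ‖iterLieDeriv (glArch n K) l φ z‖ ≤ C := by
  have hu := hφ.hasUniformModerateGrowth_of_center' hA
  have h1 : IsCuspFormGL n K hcpt (iterLieDeriv (glArch n K) l φ) := (hφ.iterLieDeriv_of_hasUniformModerateGrowth hu l).1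
  have hAl : ∀ z ∈ (AdelicGroupData.gl n K).center', ∀ g : (AdelicGroupData.gl n K).Adelic,
      iterLieDeriv (glArch n K) l φ (z * g) = iterLieDeriv (glArch n K) l φ g := by
    intro z hz g
    obtain ⟨t, rfl⟩ := hz
    have e2 : (fun y : GL (Fin n) (AdeleRing (𝓞 K) K) => φ (posRealScalar n K t * y)) = φ :=
      funext fun y => hA _ ⟨t, rfl⟩ y
    have e := congrFun (iterLieDeriv_comp_mul_left (ι := glArch n K) l φ (posRealScalar n K t)) g
    rw [e2] at e
    exact e.symm
  have hs : IsArchSmooth (glArch n K) (iterLieDeriv (glArch n K) l φ) := h1.1.archSmooth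
  exact ⟨h1, hAl, hs, h1.1.continuous_gl, h1.bounded_of_center' hAl⟩

end AGInvariant

/-! ### Telescoping the single-root decay -/

section Telescope

variable [MeasurableSpace (GL (Fin n) (AdeleRing (𝓞 K) K))] [BorelSpace (GL (Fin n) (AdeleRing (𝓞 K) K))]

/-- **Telescoped decay**: for `φ` left `GL_n(K)`-invariant with smooth, continuous, bounded iterated
archimedean derivatives, an infinite place `w`, an exponent `N` and a row index `l` with
`l + d = n - 1`: `‖W_φ(g)‖^d · r_l^N ≤ C · r_{n-1}^N` whenever `g_∞ = d κ` with `κ ∈ K_∞` and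
`diag(d)_w = (r_0, …, r_{n-1})`, `r_i > 0` (product of the single-root bounds
`‖W_φ(g)‖ · r_{k-1}^N ≤ C_k · r_k^N`, `k = l+1, …, n-1`, of
`exists_norm_whittakerDepth_zero_le_mul_pow`). [cite: CogdellAnalyticTheory2004, Thm. 1.1] -/
theorem exists_norm_whittakerDepth_zero_pow_mul_pow_le {φ : GL (Fin n) (AdeleRing (𝓞 K) K) → ℂ}
    (hφK : ∀ (γ₀ : GL (Fin n) K) (x : GL (Fin n) (AdeleRing (𝓞 K) K)),
      φ (Matrix.GeneralLinearGroup.map (algebraMap K (AdeleRing (𝓞 K) K)) γ₀ * x) = φ x)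
    (hs : ∀ l : List (archGroupGL n K).lie, IsArchSmooth (glArch n K) (iterLieDeriv (glArch n K) l φ))
    (hc : ∀ l : List (archGroupGL n K).lie, Continuous (iterLieDeriv (glArch n K) l φ))
    (hb : ∀ l : List (archGroupGL n K).lie, ∃ C : ℝ, ∀ z, ‖iterLieDeriv (glArch n K) l φ z‖ ≤ C)
    (w : InfinitePlace K) (N : ℕ) :
    ∀ (d : ℕ) (l : Fin n), (l : ℕ) + d = n - 1 →
      ∃ C : ℝ, 0 ≤ C ∧ ∀ (g : GL (Fin n) (AdeleRing (𝓞 K) K)) (dd : Fin n → (mixedSpace K)ˣ) (r : Fin n → ℝ)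
        (κ : GL (Fin n) (mixedSpace K)), (∀ i, 0 < r i) →
        (∀ i, mixedSpaceEvalAt K w (dd i : mixedSpace K) = (r i : ℂ)) → κ ∈ Kinf n K →
        GLn.toMixed n K g = glDiagonal n (mixedSpace K) dd * κ →
        ‖whittakerDepth 0 φ g‖ ^ d * r l ^ N ≤ C * r ⟨n - 1, Nat.sub_lt l.pos Nat.one_pos⟩ ^ N
  | 0, l, hl => by
    refine ⟨1, zero_le_one, fun g dd r κ _ _ _ _ => ?_⟩
    have e : l = ⟨n - 1, Nat.sub_lt l.pos Nat.one_pos⟩ := Fin.ext (by simpa using hl)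
    rw [pow_zero, one_mul, one_mul, e]
  | d + 1, l, hl => by
    have hl1 : (l : ℕ) + 1 < n := by omega
    obtain ⟨C₁, hC₁0, hC₁⟩ := exists_norm_whittakerDepth_zero_pow_mul_pow_le hφK hs hc hb w N d ⟨(l : ℕ) + 1, hl1⟩
      (by simp only; omega)
    obtain ⟨C₂, hC₂0, hC₂⟩ := exists_norm_whittakerDepth_zero_le_mul_pow hφK hs hc hb (Nat.succ_pos l) hl1 w N
    refine ⟨C₂ * C₁, mul_nonneg hC₂0 hC₁0, fun g dd r κ hr hd hκ hg => ?_⟩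
    have h1 := hC₁ g dd r κ hr hd hκ hg
    have h2 := hC₂ g dd r κ hr hd hκ hg
    have el : (⟨(l : ℕ) + 1 - 1, by omega⟩ : Fin n) = l := Fin.ext (by simp)
    rw [el] at h2
    have hrl : 0 < r l ^ N := pow_pos (hr l) N
    -- `‖W‖ r_l^N ≤ C₂ r_{l+1}^N`
    have h2' : ‖whittakerDepth 0 φ g‖ * r l ^ N ≤ C₂ * r ⟨(l : ℕ) + 1, hl1⟩ ^ N := by
      rw [div_pow, ← mul_div_assoc, le_div_iff₀ hrl] at h2
      exact h2
    have hW0 : 0 ≤ ‖whittakerDepth 0 φ g‖ := norm_nonneg _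
    calc ‖whittakerDepth 0 φ g‖ ^ (d + 1) * r l ^ N
        = ‖whittakerDepth 0 φ g‖ ^ d * (‖whittakerDepth 0 φ g‖ * r l ^ N) := by ring
      _ ≤ ‖whittakerDepth 0 φ g‖ ^ d * (C₂ * r ⟨(l : ℕ) + 1, hl1⟩ ^ N) :=
          mul_le_mul_of_nonneg_left h2' (pow_nonneg hW0 d)
      _ = C₂ * (‖whittakerDepth 0 φ g‖ ^ d * r ⟨(l : ℕ) + 1, hl1⟩ ^ N) := by ring
      _ ≤ C₂ * (C₁ * r ⟨n - 1, Nat.sub_lt l.pos Nat.one_pos⟩ ^ N) := mul_le_mul_of_nonneg_left h1 hC₂0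
      _ = C₂ * C₁ * r ⟨n - 1, Nat.sub_lt l.pos Nat.one_pos⟩ ^ N := by ring

/-- **Uniform archimedean decay of `W_φ` in every row ratio**: under the hypotheses of
`exists_norm_whittakerDepth_zero_pow_mul_pow_le`, for every infinite place `w`, exponent `M` and
row index `l` there is `C ≥ 0` with `‖W_φ(g)‖ · r_l^M ≤ C · r_{n-1}^M` whenever `g_∞ = d κ`,
`diag(d)_w = r > 0`, `κ ∈ K_∞` (`d`-th roots in the telescoped bound; the trivial bound for
`l = n - 1`). [cite: CogdellAnalyticTheory2004, Thm. 1.1] -/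
theorem exists_norm_whittakerDepth_zero_mul_pow_le {φ : GL (Fin n) (AdeleRing (𝓞 K) K) → ℂ}
    (hφK : ∀ (γ₀ : GL (Fin n) K) (x : GL (Fin n) (AdeleRing (𝓞 K) K)),
      φ (Matrix.GeneralLinearGroup.map (algebraMap K (AdeleRing (𝓞 K) K)) γ₀ * x) = φ x)
    (hs : ∀ l : List (archGroupGL n K).lie, IsArchSmooth (glArch n K) (iterLieDeriv (glArch n K) l φ))
    (hc : ∀ l : List (archGroupGL n K).lie, Continuous (iterLieDeriv (glArch n K) l φ))
    (hb : ∀ l : List (archGroupGL n K).lie, ∃ C : ℝ, ∀ z, ‖iterLieDeriv (glArch n K) l φ z‖ ≤ C)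
    (w : InfinitePlace K) (M : ℕ) (l : Fin n) :
    ∃ C : ℝ, 0 ≤ C ∧ ∀ (g : GL (Fin n) (AdeleRing (𝓞 K) K)) (dd : Fin n → (mixedSpace K)ˣ) (r : Fin n → ℝ)
      (κ : GL (Fin n) (mixedSpace K)), (∀ i, 0 < r i) →
      (∀ i, mixedSpaceEvalAt K w (dd i : mixedSpace K) = (r i : ℂ)) → κ ∈ Kinf n K →
      GLn.toMixed n K g = glDiagonal n (mixedSpace K) dd * κ →
      ‖whittakerDepth 0 φ g‖ * r l ^ M ≤ C * r ⟨n - 1, Nat.sub_lt l.pos Nat.one_pos⟩ ^ M := by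
  obtain ⟨d, hd⟩ : ∃ d : ℕ, (l : ℕ) + d = n - 1 := ⟨n - 1 - l, by omega⟩
  rcases Nat.eq_zero_or_pos d with rfl | hdpos
  · -- `l = n - 1`: the trivial bound
    obtain ⟨B, hB⟩ := hb []
    refine ⟨max B 0, le_max_right _ _, fun g dd r κ hr _ _ _ => ?_⟩
    have e : l = ⟨n - 1, Nat.sub_lt l.pos Nat.one_pos⟩ := Fin.ext (by simpa using hd)
    rw [← e]
    refine mul_le_mul_of_nonneg_right ((norm_whittakerDepth_le (fun z => ?_) 0 g).trans (le_max_left B 0))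
      (pow_nonneg (hr l).le M)
    exact hB z
  · obtain ⟨C, hC0, hC⟩ := exists_norm_whittakerDepth_zero_pow_mul_pow_le hφK hs hc hb w (d * M) d l hd
    refine ⟨C ^ ((d : ℝ)⁻¹), Real.rpow_nonneg hC0 _, fun g dd r κ hr hdd hκ hg => ?_⟩
    have h := hC g dd r κ hr hdd hκ hg
    have hd0 : d ≠ 0 := Nat.pos_iff_ne_zero.1 hdpos
    have hW0 : 0 ≤ ‖whittakerDepth 0 φ g‖ := norm_nonneg _
    have hrn : 0 ≤ r ⟨n - 1, Nat.sub_lt l.pos Nat.one_pos⟩ ^ M := pow_nonneg (hr _).le M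
    rw [← pow_le_pow_iff_left₀ (mul_nonneg hW0 (pow_nonneg (hr l).le M)) (mul_nonneg (Real.rpow_nonneg hC0 _) hrn) hd0,
      mul_pow, mul_pow, ← pow_mul, Real.rpow_inv_natCast_pow hC0 hd0, ← pow_mul, mul_comm M d]
    exact h

end Telescope

/-! ### The decay estimate for an arbitrary cusp form on a determinant slice -/

section CuspForm

variable [MeasurableSpace (GL (Fin n) (AdeleRing (𝓞 K) K))] [BorelSpace (GL (Fin n) (AdeleRing (𝓞 K) K))]

/-- **Uniform archimedean decay of the Whittaker transform of a cusp form on a determinant slice.**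
For a cusp form `φ` on `GL_n(𝔸_K)` (`n ≥ 1`, no central character assumed), a base point `x₀`, an
infinite place `w`, an exponent `M` and a row index `l` there is `C ≥ 0` such that
`‖W_φ(g)‖ · r_l^M ≤ C · r_{n-1}^M` for every `g` with `|det g|_𝔸 = |det x₀|_𝔸` and Iwasawa
coordinates `g_∞ = d κ`, `diag(d)_w = r > 0`, `κ ∈ K_∞`. Proof: replace `φ` by the `A_G`-invariant
cusp form `φ♭ = φ ∘ r_{x₀}` (`isCuspFormGL_sliceExtend`), which has the same Whittaker transform on
the slice (`whittakerDepth_sliceExtend_eq`) and bounded smooth derivatives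
(`IsCuspFormGL.isArchSmooth_continuous_bounded_iterLieDeriv_of_center'`), and telescope the
single-root decay (`exists_norm_whittakerDepth_zero_mul_pow_le`).
[cite: CogdellAnalyticTheory2004, Thm. 1.1] -/
theorem IsCuspFormGL.exists_norm_whittakerDepth_zero_mul_pow_le [NeZero n]
    {φ : GL (Fin n) (AdeleRing (𝓞 K) K) → ℂ} (hφ : IsCuspFormGL n K (isCompact_glFiniteIntegralLevel_holds n K) φ)
    (x₀ : GL (Fin n) (AdeleRing (𝓞 K) K)) (w : InfinitePlace K) (M : ℕ) (l : Fin n) :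
    ∃ C : ℝ, 0 ≤ C ∧ ∀ (g : GL (Fin n) (AdeleRing (𝓞 K) K)) (dd : Fin n → (mixedSpace K)ˣ) (r : Fin n → ℝ)
      (κ : GL (Fin n) (mixedSpace K)), (∀ i, 0 < r i) →
      (∀ i, mixedSpaceEvalAt K w (dd i : mixedSpace K) = (r i : ℂ)) → κ ∈ Kinf n K →
      GLn.toMixed n K g = glDiagonal n (mixedSpace K) dd * κ → detNormUnit n K g = detNormUnit n K x₀ →
      ‖whittakerDepth 0 φ g‖ * r l ^ M ≤ C * r ⟨n - 1, Nat.sub_lt l.pos Nat.one_pos⟩ ^ M := by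
  have hφ' := isCuspFormGL_sliceExtend hφ x₀
  have hA' : ∀ z ∈ (AdelicGroupData.gl n K).center', ∀ g : (AdelicGroupData.gl n K).Adelic,
      sliceExtend n K x₀ φ (z * g) = sliceExtend n K x₀ φ g :=
    fun z hz g => sliceExtend_center'_mul z hz g
  have hpack := fun l' => hφ'.isArchSmooth_continuous_bounded_iterLieDeriv_of_center' hA' l'
  have hφK' : ∀ (γ₀ : GL (Fin n) K) (x : GL (Fin n) (AdeleRing (𝓞 K) K)),
      sliceExtend n K x₀ φ (Matrix.GeneralLinearGroup.map (algebraMap K (AdeleRing (𝓞 K) K)) γ₀ * x) =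
        sliceExtend n K x₀ φ x :=
    fun γ₀ x => hφ'.1.leftInvariant _ (show _ ∈ rationalPointsGL n K from ⟨γ₀, rfl⟩) x
  obtain ⟨C, hC0, hC⟩ := Literature.NumberTheory.Automorphic.exists_norm_whittakerDepth_zero_mul_pow_le hφK'
    (fun l' => (hpack l').2.2.1)
    (fun l' => (hpack l').2.2.2.1) (fun l' => (hpack l').2.2.2.2) w M l
  refine ⟨C, hC0, fun g dd r κ hr hdd hκ hg hz => ?_⟩
  rw [← whittakerDepth_sliceExtend_eq x₀ φ 0 hz]
  exact hC g dd r κ hr hdd hκ hg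

end CuspForm

end Literature.NumberTheory.Automorphic
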